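import Literature.Analysis.Calculus.LogCutoff
import Literature.Geometry.Symplectic.BlockReparam
import Mathlib.Analysis.InnerProductSpace.Calculus
import Mathlib.Analysis.Calculus.Deriv.Comp
import HarnessLib

/-!
# A logarithmic cut-off on the model tube, radial in the normal directions

Topic `Geometry/Symplectic`; namespace `Literature.Geometry.Symplectic`.  Theorems only; no named
fact, no `sorry`.  From the one-variable logarithmic cut-off `exists_logCutoff` (Bär–Hanke) we
build, for every `η > 0` and outer radius `r₁ > 0`, an inner radius `0 < r₀ < r₁` and a `C^∞`
function `ρ : ℝ⁴ → [0, 1]` of the squared distance `|x|² = ‖q - q₀ e₀‖²` to the axis, with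
`ρ = 1` for `|x| ≤ r₀`, `ρ = 0` for `|x| ≥ r₁`, invariant under the axis translations, and with
the LOGARITHMIC derivative bound `|x| · ‖dρ_q‖ ≤ 2η` (`exists_tubeLogCutoff`).  This is the
cut-off of the gluing `ω' = ω + d(ρ · K(ω_A − ω))` along an even zero circle: its gradient term
`dρ ∧ K(ω_A − ω) = O(η |x|)` is then small against the main term `|x|`.

## References

* C. Bär, B. Hanke, *Boundary conditions for scalar curvature*, in: Perspectives in Scalar
  Curvature (2023), §3, Lemma 25 (logarithmic cut-offs). [BarHanke2023]
* T. Perutz, *Zero-sets of near-symplectic forms*, J. Symplectic Geom. 4 (2006), §3.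
  [Perutz2006]
-/

noncomputable section

open scoped Manifold ContDiff Topology
open Set Function Filter Metric Literature.Analysis.Calculus

namespace Literature.Geometry.Symplectic

/-! ### The normal part as a linear map -/

/-- The normal projection `q ↦ q - q₀ e₀` as a continuous linear map (existence with its
defining formula; used only inside this file). [folklore] -/
theorem exists_normalProjCLM :
    ∃ L : EuclideanSpace ℝ (Fin 4) →L[ℝ] EuclideanSpace ℝ (Fin 4),
      ∀ q, L q = q - hondaAxisPoint (q 0) :=
  ⟨ContinuousLinearMap.id ℝ _ - (EuclideanSpace.proj (0 : Fin 4)).smulRight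
      (EuclideanSpace.single (0 : Fin 4) (1 : ℝ)), fun _ ↦ rfl⟩

/-- `‖q - q₀ e₀‖² = q₁² + q₂² + q₃²`. [folklore] -/
theorem norm_sub_hondaAxisPoint_sq (q : EuclideanSpace ℝ (Fin 4)) :
    ‖q - hondaAxisPoint (q 0)‖ ^ 2 = q 1 ^ 2 + q 2 ^ 2 + q 3 ^ 2 := by
  rw [hondaAxisPoint_eq_single]; exact norm_sub_single_sq q

/-- The normal part is shorter than the vector: `‖q - q₀ e₀‖ ≤ ‖q‖`. [folklore] -/
theorem norm_sub_hondaAxisPoint_le (q : EuclideanSpace ℝ (Fin 4)) :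
    ‖q - hondaAxisPoint (q 0)‖ ≤ ‖q‖ := by
  refine le_of_sq_le_sq ?_ (norm_nonneg _)
  rw [norm_sub_hondaAxisPoint_sq, ← sum_sq_four_eq_norm_sq]
  nlinarith [sq_nonneg (q 0)]

/-- The normal part is invariant under axis translations. [folklore] -/
theorem sub_hondaAxisPoint_add_smul (q : EuclideanSpace ℝ (Fin 4)) (c : ℝ) :
    (q + c • EuclideanSpace.single (0 : Fin 4) (1 : ℝ)) -
        hondaAxisPoint ((q + c • EuclideanSpace.single (0 : Fin 4) (1 : ℝ)) 0) =
      q - hondaAxisPoint (q 0) := by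
  have h0 : (q + c • EuclideanSpace.single (0 : Fin 4) (1 : ℝ)) 0 = q 0 + c := by simp
  rw [h0, hondaAxisPoint_add]
  abel

/-! ### The cut-off -/

/-- **Logarithmic cut-off on the model tube.**  For `η > 0` and `r₁ > 0` there are `0 < r₀ < r₁`
and a `C^∞` function `ρ : ℝ⁴ → [0, 1]` depending only on the distance `|x|` to the axis, equal
to `1` for `|x| ≤ r₀` and to `0` for `|x| ≥ r₁`, invariant under axis translations, with
`|x| ‖dρ‖ ≤ 2η`. [cite: BarHanke2023, §3 Lemma 25] -/
theorem exists_tubeLogCutoff {η r₁ : ℝ} (hη : 0 < η) (hr₁ : 0 < r₁) :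
    ∃ r₀ : ℝ, 0 < r₀ ∧ r₀ < r₁ ∧ ∃ ρ : EuclideanSpace ℝ (Fin 4) → ℝ, ContDiff ℝ ∞ ρ ∧
      (∀ q, ‖q - hondaAxisPoint (q 0)‖ ≤ r₀ → ρ q = 1) ∧
      (∀ q, r₁ ≤ ‖q - hondaAxisPoint (q 0)‖ → ρ q = 0) ∧
      (∀ q, ρ q ∈ Icc (0 : ℝ) 1) ∧
      (∀ q (c : ℝ), ρ (q + c • EuclideanSpace.single (0 : Fin 4) (1 : ℝ)) = ρ q) ∧
      (∀ q, ‖q - hondaAxisPoint (q 0)‖ * ‖fderiv ℝ ρ q‖ ≤ 2 * η) ∧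
      (∀ q, ‖q - hondaAxisPoint (q 0)‖ < r₀ → fderiv ℝ ρ q = 0) ∧
      (∀ q, r₁ < ‖q - hondaAxisPoint (q 0)‖ → fderiv ℝ ρ q = 0) := by
  obtain ⟨t₀, ht₀, ht₀₁, τ, hτs, hτ1, hτ0, hτI, hτd, -⟩ :=
    exists_logCutoff hη (pow_pos hr₁ 2)
  obtain ⟨L, hL⟩ := exists_normalProjCLM
  -- the squared distance to the axis
  set N : EuclideanSpace ℝ (Fin 4) → ℝ := fun q ↦ ‖q - hondaAxisPoint (q 0)‖ ^ 2 with hN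
  have hNL : N = fun q ↦ ‖L q‖ ^ 2 := by funext q; rw [hN, hL]
  have hNs : ContDiff ℝ ∞ N := by rw [hNL]; exact (contDiff_norm_sq ℝ).comp L.contDiff
  have hNd : ∀ q, HasFDerivAt N ((2 : ℝ) • (innerSL ℝ (L q)).comp L) q := fun q ↦ by
    rw [hNL]
    refine ((L.hasFDerivAt (x := q)).norm_sq).congr_fderiv ?_
    rw [← Nat.cast_smul_eq_nsmul ℝ, Nat.cast_ofNat]
  have hLn : ‖L‖ ≤ 1 := by
    refine L.opNorm_le_bound zero_le_one fun q ↦ ?_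
    rw [one_mul, hL]; exact norm_sub_hondaAxisPoint_le q
  have hdist : Continuous fun q : EuclideanSpace ℝ (Fin 4) ↦ ‖q - hondaAxisPoint (q 0)‖ := by
    have : (fun q : EuclideanSpace ℝ (Fin 4) ↦ ‖q - hondaAxisPoint (q 0)‖) = fun q ↦ ‖L q‖ :=
      funext fun q ↦ by rw [hL]
    rw [this]; exact continuous_norm.comp L.continuous
  have h1r : ∀ q, ‖q - hondaAxisPoint (q 0)‖ ≤ Real.sqrt t₀ → τ (N q) = 1 := by
    intro q hq
    refine hτ1 _ ?_
    have h0 : 0 ≤ ‖q - hondaAxisPoint (q 0)‖ := norm_nonneg _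
    calc N q = ‖q - hondaAxisPoint (q 0)‖ ^ 2 := rfl
      _ ≤ Real.sqrt t₀ ^ 2 := pow_le_pow_left₀ h0 hq 2
      _ = t₀ := Real.sq_sqrt ht₀.le
  have h0r : ∀ q, r₁ ≤ ‖q - hondaAxisPoint (q 0)‖ → τ (N q) = 0 := fun q hq ↦
    hτ0 _ (by simpa [hN] using pow_le_pow_left₀ hr₁.le hq 2)
  refine ⟨Real.sqrt t₀, Real.sqrt_pos.2 ht₀, ?_, fun q ↦ τ (N q), hτs.comp hNs, h1r, h0r,
    fun q ↦ hτI _, ?_, ?_, ?_, ?_⟩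
  · calc Real.sqrt t₀ < Real.sqrt (r₁ ^ 2) := Real.sqrt_lt_sqrt ht₀.le ht₀₁
      _ = r₁ := Real.sqrt_sq hr₁.le
  · intro q c
    simp only [hN, sub_hondaAxisPoint_add_smul]
  · intro q
    -- chain rule and the logarithmic bound `|t τ'(t)| ≤ η`
    have hd : HasFDerivAt (fun q ↦ τ (N q))
        (deriv τ (N q) • ((2 : ℝ) • (innerSL ℝ (L q)).comp L)) q :=
      (hτs.differentiable (by simp) (N q)).hasDerivAt.comp_hasFDerivAt q (hNd q)
    rw [hd.fderiv]
    have hnorm : ‖deriv τ (N q) • ((2 : ℝ) • (innerSL ℝ (L q)).comp L)‖ ≤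
        |deriv τ (N q)| * (2 * ‖q - hondaAxisPoint (q 0)‖) := by
      rw [norm_smul, Real.norm_eq_abs]
      refine mul_le_mul_of_nonneg_left ?_ (abs_nonneg _)
      rw [norm_smul, Real.norm_two]
      refine mul_le_mul_of_nonneg_left ?_ zero_le_two
      refine (ContinuousLinearMap.opNorm_comp_le _ _).trans ?_
      rw [innerSL_apply_norm, hL]
      calc ‖q - hondaAxisPoint (q 0)‖ * ‖L‖ ≤ ‖q - hondaAxisPoint (q 0)‖ * 1 :=
            mul_le_mul_of_nonneg_left hLn (norm_nonneg _)
        _ = ‖q - hondaAxisPoint (q 0)‖ := mul_one _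
    by_cases h0 : ‖q - hondaAxisPoint (q 0)‖ = 0
    · rw [h0, zero_mul]; positivity
    · have hpos : 0 < N q := by
        have : 0 < ‖q - hondaAxisPoint (q 0)‖ := lt_of_le_of_ne (norm_nonneg _) (Ne.symm h0)
        exact pow_pos this 2
      have hb := hτd (N q) hpos
      rw [abs_mul, abs_of_pos hpos] at hb
      calc ‖q - hondaAxisPoint (q 0)‖ * ‖deriv τ (N q) • ((2 : ℝ) • (innerSL ℝ (L q)).comp L)‖
          ≤ ‖q - hondaAxisPoint (q 0)‖ * (|deriv τ (N q)| * (2 * ‖q - hondaAxisPoint (q 0)‖)) :=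
            mul_le_mul_of_nonneg_left hnorm (norm_nonneg _)
        _ = 2 * (N q * |deriv τ (N q)|) := by simp only [hN]; ring
        _ ≤ 2 * η := by linarith
  · -- inside the core `ρ` is locally the constant `1`
    intro q hq
    have hev : (fun q ↦ τ (N q)) =ᶠ[𝓝 q] fun _ ↦ (1 : ℝ) := by
      filter_upwards [(isOpen_lt hdist continuous_const).mem_nhds hq] with q' hq'
      exact h1r q' hq'.le
    rw [hev.fderiv_eq]; exact fderiv_const_apply (1 : ℝ)
  · -- outside the shell `ρ` is locally the constant `0`
    intro q hq
    have hev : (fun q ↦ τ (N q)) =ᶠ[𝓝 q] fun _ ↦ (0 : ℝ) := by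
      filter_upwards [(isOpen_lt continuous_const hdist).mem_nhds hq] with q' hq'
      exact h0r q' hq'.le
    rw [hev.fderiv_eq]; exact fderiv_const_apply (0 : ℝ)

/-! ### A plain cut-off between two radii -/

/-- **A smooth cut-off between two tube radii**: `ψ = 1` for `|x| ≤ r₂`, `ψ = 0` for `|x| ≥ r₃`,
invariant under axis translations (Mathlib's smooth transition in `|x|²`). [folklore] -/
theorem exists_tubeCutoff {r₂ r₃ : ℝ} (hr₂ : 0 < r₂) (h : r₂ < r₃) :
    ∃ ψ : EuclideanSpace ℝ (Fin 4) → ℝ, ContDiff ℝ ∞ ψ ∧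
      (∀ q, ‖q - hondaAxisPoint (q 0)‖ ≤ r₂ → ψ q = 1) ∧
      (∀ q, r₃ ≤ ‖q - hondaAxisPoint (q 0)‖ → ψ q = 0) ∧
      (∀ q (c : ℝ), ψ (q + c • EuclideanSpace.single (0 : Fin 4) (1 : ℝ)) = ψ q) := by
  obtain ⟨L, hL⟩ := exists_normalProjCLM
  set N : EuclideanSpace ℝ (Fin 4) → ℝ := fun q ↦ ‖q - hondaAxisPoint (q 0)‖ ^ 2 with hN
  have hNL : N = fun q ↦ ‖L q‖ ^ 2 := by funext q; rw [hN, hL]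
  have hNs : ContDiff ℝ ∞ N := by rw [hNL]; exact (contDiff_norm_sq ℝ).comp L.contDiff
  have hd : 0 < r₃ ^ 2 - r₂ ^ 2 := by nlinarith
  set lam : ℝ := 1 / (r₃ ^ 2 - r₂ ^ 2) with hlam
  have hlam0 : 0 < lam := by positivity
  set R : ℝ := lam * r₃ ^ 2 with hR
  have hR1 : R - 1 = lam * r₂ ^ 2 := by
    rw [hR, hlam]; field_simp; ring
  refine ⟨fun q ↦ cutoff R (lam * N q), ?_, ?_, ?_, ?_⟩
  · exact (contDiff_cutoff R (n := ⊤)).comp (contDiff_const.mul hNs)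
  · intro q hq
    refine cutoff_eq_one ?_
    have h0 : 0 ≤ ‖q - hondaAxisPoint (q 0)‖ := norm_nonneg _
    have hNq : N q ≤ r₂ ^ 2 := pow_le_pow_left₀ h0 hq 2
    have hN0 : 0 ≤ N q := by positivity
    rw [abs_of_nonneg (by positivity), hR1]
    exact mul_le_mul_of_nonneg_left hNq hlam0.le
  · intro q hq
    refine cutoff_eq_zero ?_
    have hNq : r₃ ^ 2 ≤ N q := pow_le_pow_left₀ (by linarith) hq 2
    rw [abs_of_nonneg (by positivity), hR]
    exact mul_le_mul_of_nonneg_left hNq hlam0.le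
  · intro q c
    simp only [hN, sub_hondaAxisPoint_add_smul]

end Literature.Geometry.Symplectic

end
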